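import Mathlib
import HarnessLib
import Summits.NavierStokesRegularity.NavierStokesRegularity.Theorems.UnthreadedRigidityDoorUnthreadedRigidityProfileHornDefs

/-!
# Route `UnthreadedRigidityDoor`, wall item W2 `UnthreadedRigidity` (stmt-NavierStokesRegularity-27585) — LINE g12-3 «POLYHEDRAL LIOUVILLE»
# (ns-idea-6 g12, `Polyhedral_sketch.lean` v1.1 f444ccd4a908a458 / v1 260d2023b792867d; DIRECTOR-NS #294): support S-ISO
# `IsotropicFieldVanishes`, VERBATIM (the sketch-local `IsInfSym` unfolded) — a PORT of the author's sorry-free proof `isotropicFieldVanishes_holds`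

Seat ns-es-p1 g8 (W2 second queue; announce-before-propose on the ideators bus).  The mathematics and the proof are ns-idea-6 g12's (sketch §5, v1.1);
this file only re-homes it under `Theorems/` without the sketch-local definitions (`IsInfSym` unfolded; the rank-two skew maps `⟪a,·⟫b − ⟪b,·⟫a` and the
radial coefficient `φ = ⟪f, x−x₀⟫/‖x−x₀‖²` written out), so that the compositions of the line can cite it by name.

* `isotropicFieldVanishes` — **S-ISO VERBATIM**: a differentiable divergence-free field on `ℝ³` all of whose skew operators are infinitesimal rotational
  symmetries about `x₀` (`Df(x)·A(x−x₀) = A f(x)` for every skew `A`) vanishes identically.  PROOF (author's, direct): two vectors of `ℝ³` have a common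
  nonzero perpendicular, whence `f(x) ∥ x − x₀` off the centre; `f = φ·(x − x₀)` with `φ` differentiable off the centre; `div f = 3φ + ∂_{x−x₀}φ = 0`; along
  each ray `K(s) = s²⟪f(x₀ + s y₀), y₀⟫` has `K′ = 0` on `(0,∞)` and `K(0) = 0`, so `K ≡ 0`, `f ≡ 0` off the centre and, by density, everywhere.

HONEST LABEL: a support of a files-only rung line (model/rung work); nothing here bears on `UnthreadedRigidity` (27585), the door Target, W2 or Navier–Stokes
regularity; no summit statement is proved.
-/

noncomputable section

-- the summit and its single sub-problem share the name (CONVENTIONS §1), as in every Theorems file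
set_option linter.dupNamespace false

namespace Summit.NavierStokesRegularity.NavierStokesRegularity.Theorems.UnthreadedRigidity.Polyhedral

open Set Filter Topology
open Summit.NavierStokesRegularity.NavierStokesRegularity.Theorems.UnthreadedRigidity.ProfileHorn (E3)

/-- In `E3`, two vectors have a common nonzero perpendicular (dimension count). -/
theorem exists_perp_perp (y a : E3) : ∃ b : E3, b ≠ 0 ∧ inner ℝ y b = 0 ∧ inner ℝ a b = 0 := by
  set K : Submodule ℝ E3 := (ℝ ∙ y) ⊔ (ℝ ∙ a) with hK
  have h1 : Module.finrank ℝ K ≤ 2 := by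
    calc Module.finrank ℝ K ≤ Module.finrank ℝ (ℝ ∙ y) + Module.finrank ℝ (ℝ ∙ a) :=
          Submodule.finrank_add_le_finrank_add_finrank _ _
      _ ≤ 1 + 1 := Nat.add_le_add (by simpa using finrank_span_le_card ({y} : Set E3))
          (by simpa using finrank_span_le_card ({a} : Set E3))
  have h2 : Module.finrank ℝ K + Module.finrank ℝ Kᗮ = 3 := by
    rw [Submodule.finrank_add_finrank_orthogonal, finrank_euclideanSpace_fin]
  have h3 : Kᗮ ≠ ⊥ := by
    intro hb
    rw [hb, finrank_bot] at h2
    omega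
  obtain ⟨b, hb, hb0⟩ := Submodule.exists_mem_ne_zero_of_ne_bot h3
  rw [Submodule.mem_orthogonal] at hb
  exact ⟨b, hb0, hb y (Submodule.mem_sup_left (Submodule.mem_span_singleton_self y)),
    hb a (Submodule.mem_sup_right (Submodule.mem_span_singleton_self a))⟩

variable {f : E3 → E3} {x₀ : E3}

/-- STEP D: if every skew operator is an infinitesimal symmetry, `f x` is orthogonal to every vector orthogonal to `x − x₀` (test with the rank-two skew map
`v ↦ ⟪a,v⟫ b − ⟪b,v⟫ a`, `b` a common perpendicular of `x − x₀` and `a`). -/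
theorem inner_eq_zero_of_perp
    (hall : ∀ A : E3 →L[ℝ] E3, (∀ x, inner ℝ (A x) x = 0) → ((∀ x, inner ℝ (A x) x = 0) ∧ ∀ x, fderiv ℝ f x (A (x - x₀)) - A (f x) = 0))
    (x a : E3) (ha : inner ℝ a (x - x₀) = 0) : inner ℝ a (f x) = 0 := by
  obtain ⟨b, hb0, hyb, hab⟩ := exists_perp_perp (x - x₀) a
  set S : E3 →L[ℝ] E3 := (innerSL ℝ a).smulRight b - (innerSL ℝ b).smulRight a with hS_def
  have hS : ∀ v : E3, S v = (inner ℝ a v) • b - (inner ℝ b v) • a := fun v => by simp [hS_def]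
  have hSskew : ∀ v : E3, inner ℝ (S v) v = 0 := fun v => by
    rw [hS, inner_sub_left, real_inner_smul_left, real_inner_smul_left]; ring
  have h := (hall S hSskew).2 x
  have hk : S (x - x₀) = 0 := by
    rw [hS, ha, real_inner_comm, hyb, zero_smul, zero_smul, sub_zero]
  rw [hk, map_zero, zero_sub, neg_eq_zero, hS] at h
  have h' := congrArg (fun z => inner ℝ z b) h
  simp only [inner_sub_left, real_inner_smul_left, inner_zero_left, hab, mul_zero, sub_zero] at h'
  rcases mul_eq_zero.mp h' with h'' | h''
  · exact h''
  · exact absurd (inner_self_eq_zero.mp h'') hb0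

/-- **S-ISO `IsotropicFieldVanishes` (VERBATIM, `IsInfSym` unfolded): a differentiable divergence-free field with full infinitesimal isotropy about `x₀` is
zero** (module docstring for the proof; author ns-idea-6 g12). -/
theorem isotropicFieldVanishes :
    ∀ (f : E3 → E3) (x₀ : E3), Differentiable ℝ f → Literature.Analysis.FluidPDE.VectorCalculus.IsDivFree f →
      (∀ A : E3 →L[ℝ] E3, (∀ x, inner ℝ (A x) x = 0) →
        ((∀ x, inner ℝ (A x) x = 0) ∧ ∀ x, fderiv ℝ f x (A (x - x₀)) - A (f x) = 0)) → ∀ x, f x = 0 := by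
  intro f x₀ hf hdiv hall
  -- the radial coefficient
  set φ : E3 → ℝ := fun z => inner ℝ (f z) (z - x₀) / ‖z - x₀‖ ^ 2 with hφ
  -- STEP E: `f x = φ x • (x − x₀)` off the centre
  have parallel : ∀ x : E3, x ≠ x₀ → f x = φ x • (x - x₀) := by
    intro x hx
    have hy : ‖x - x₀‖ ^ 2 ≠ 0 := by
      have : x - x₀ ≠ 0 := sub_ne_zero.mpr hx
      positivity
    set r := f x - φ x • (x - x₀) with hr
    have hry : inner ℝ r (x - x₀) = 0 := by
      rw [hr, inner_sub_left, real_inner_smul_left, real_inner_self_eq_norm_sq, hφ]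
      simp only
      rw [div_mul_cancel₀ _ hy, sub_self]
    have hrf : inner ℝ r (f x) = 0 := inner_eq_zero_of_perp hall x r hry
    have hrr : inner ℝ r r = 0 := by
      have : r = f x - φ x • (x - x₀) := hr
      conv_lhs => rw [this]; rw [inner_sub_right]
      rw [hrf, real_inner_smul_right, hry, mul_zero, sub_zero]
    have hr0 : r = 0 := inner_self_eq_zero.mp hrr
    rw [hr] at hr0
    exact (sub_eq_zero.mp hr0)
  -- `φ` is differentiable off the centre
  have φdiff : ∀ x : E3, x ≠ x₀ → DifferentiableAt ℝ φ x := by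
    intro x hx
    have hy : ‖x - x₀‖ ^ 2 ≠ 0 := by
      have : x - x₀ ≠ 0 := sub_ne_zero.mpr hx
      positivity
    have h1 : DifferentiableAt ℝ (fun z => inner ℝ (f z) (z - x₀)) x :=
      (hf x).inner ℝ (differentiableAt_id.sub_const x₀)
    have h2 : DifferentiableAt ℝ (fun z => ‖z - x₀‖ ^ 2) x := by
      simpa using (differentiableAt_id.sub_const x₀).norm_sq ℝ (x := x)
    show DifferentiableAt ℝ (fun z => inner ℝ (f z) (z - x₀) / ‖z - x₀‖ ^ 2) x
    simp_rw [div_eq_mul_inv]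
    exact h1.mul (h2.inv hy)
  -- STEP F: the derivative of `f` off the centre
  have hasFDerivAt_f : ∀ x : E3, x ≠ x₀ →
      HasFDerivAt f (φ x • ContinuousLinearMap.id ℝ E3 + (fderiv ℝ φ x).smulRight (x - x₀)) x := by
    intro x hx
    have hg : HasFDerivAt (fun z => φ z • (z - x₀))
        (φ x • ContinuousLinearMap.id ℝ E3 + (fderiv ℝ φ x).smulRight (x - x₀)) x :=
      (φdiff x hx).hasFDerivAt.smul ((hasFDerivAt_id x).sub_const x₀)
    refine hg.congr_of_eventuallyEq ?_
    filter_upwards [isOpen_ne.mem_nhds hx] with z hz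
    exact parallel z hz
  -- the divergence off the centre: `div f = 3φ + ∂_{x−x₀} φ`
  have divg_eq : ∀ x : E3, x ≠ x₀ →
      Literature.Analysis.FluidPDE.VectorCalculus.divergence f x = 3 * φ x + fderiv ℝ φ x (x - x₀) := by
    intro x hx
    rw [Literature.Analysis.FluidPDE.VectorCalculus.divergence, (hasFDerivAt_f x hx).fderiv]
    have e1 : ((φ x • ContinuousLinearMap.id ℝ E3 + (fderiv ℝ φ x).smulRight (x - x₀) : E3 →L[ℝ] E3) : E3 →ₗ[ℝ] E3)
        = φ x • LinearMap.id + ((fderiv ℝ φ x : E3 →L[ℝ] ℝ) : E3 →ₗ[ℝ] ℝ).smulRight (x - x₀) := by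
      ext v; simp
    rw [e1, map_add, map_smul, LinearMap.trace_id, LinearMap.trace_smulRight, finrank_euclideanSpace_fin]
    simp only [smul_eq_mul, Nat.cast_ofNat, ContinuousLinearMap.coe_coe]
    ring
  -- STEP G/H: along every ray `⟪f(x₀ + y₀), y₀⟫ = 0`
  have ray_zero : ∀ y₀ : E3, y₀ ≠ 0 → inner ℝ (f (x₀ + y₀)) y₀ = 0 := by
    intro y₀ hy₀
    set K : ℝ → ℝ := fun s => s ^ 2 * inner ℝ (f (x₀ + s • y₀)) y₀ with hK
    have hderiv : ∀ s : ℝ, 0 < s → HasDerivAt K 0 s := by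
      intro s hs
      have hps : x₀ + s • y₀ ≠ x₀ := by
        intro h
        have : s • y₀ = 0 := by simpa using h
        rcases smul_eq_zero.mp this with h1 | h1
        · exact absurd h1 hs.ne'
        · exact hy₀ h1
      have hp : HasDerivAt (fun t : ℝ => x₀ + t • y₀) y₀ s := by
        simpa using ((hasDerivAt_id s).smul_const y₀).const_add x₀
      have hfp : HasDerivAt (fun t : ℝ => f (x₀ + t • y₀))
          ((φ (x₀ + s • y₀) • ContinuousLinearMap.id ℝ E3 + (fderiv ℝ φ (x₀ + s • y₀)).smulRight (x₀ + s • y₀ - x₀)) y₀) s :=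
        (hasFDerivAt_f _ hps).comp_hasDerivAt s hp
      have hin : HasDerivAt (fun t : ℝ => inner ℝ (f (x₀ + t • y₀)) y₀)
          (inner ℝ (f (x₀ + s • y₀)) (0 : E3) + inner ℝ ((φ (x₀ + s • y₀) • ContinuousLinearMap.id ℝ E3 +
            (fderiv ℝ φ (x₀ + s • y₀)).smulRight (x₀ + s • y₀ - x₀)) y₀) y₀) s :=
        hfp.inner ℝ (hasDerivAt_const s y₀)
      have hKd := (hasDerivAt_pow 2 s).mul hin
      have hpar : f (x₀ + s • y₀) = φ (x₀ + s • y₀) • (s • y₀) := by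
        simpa using parallel _ hps
      have hd0 : 3 * φ (x₀ + s • y₀) + fderiv ℝ φ (x₀ + s • y₀) (s • y₀) = 0 := by
        have := divg_eq _ hps
        rw [hdiv, add_sub_cancel_left] at this
        linarith
      rw [map_smul, smul_eq_mul] at hd0
      refine (hKd.congr_deriv ?_ : HasDerivAt K 0 s)
      rw [hpar]
      simp only [inner_zero_right, zero_add, _root_.add_apply, _root_.smul_apply,
        ContinuousLinearMap.id_apply, ContinuousLinearMap.smulRight_apply, add_sub_cancel_left,
        inner_add_left, real_inner_smul_left, Nat.cast_ofNat, Nat.add_one_sub_one, pow_one]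
      linear_combination (inner ℝ y₀ y₀ * s ^ 2) * hd0
    have hconst : ∀ s : ℝ, 0 < s → K s = K 1 := by
      intro s hs
      refine IsOpen.is_const_of_deriv_eq_zero isOpen_Ioi isPreconnected_Ioi
        (fun t ht => (hderiv t ht).differentiableAt.differentiableWithinAt)
        (fun t ht => by simpa using (hderiv t ht).deriv) (Set.mem_Ioi.mpr hs) (Set.mem_Ioi.mpr one_pos)
    have hKc : Continuous K := by
      have hc : Continuous fun t : ℝ => x₀ + t • y₀ := continuous_const.add (continuous_id.smul continuous_const)
      exact (continuous_pow 2).mul ((hf.continuous.comp hc).inner continuous_const)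
    have h0 : K 0 = 0 := by simp [hK]
    have hlim1 : Tendsto K (𝓝[>] (0 : ℝ)) (𝓝 (K 0)) := (hKc.tendsto 0).mono_left nhdsWithin_le_nhds
    have hlim2 : Tendsto K (𝓝[>] (0 : ℝ)) (𝓝 (K 1)) := by
      refine (tendsto_const_nhds (x := K 1)).congr' ?_
      filter_upwards [self_mem_nhdsWithin] with s hs
      exact (hconst s hs).symm
    have h01 : K 0 = K 1 := tendsto_nhds_unique hlim1 hlim2
    have hK1 : K 1 = inner ℝ (f (x₀ + y₀)) y₀ := by simp [hK]
    rw [← hK1, ← h01, h0]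
  -- conclusion: `f ≡ 0` off the centre, hence everywhere by continuity
  have hoff : ∀ x, x ≠ x₀ → f x = 0 := by
    intro x hx
    have hy : x - x₀ ≠ 0 := sub_ne_zero.mpr hx
    have h := ray_zero (x - x₀) hy
    rw [add_sub_cancel] at h
    rw [parallel x hx, hφ]
    simp only
    rw [h, zero_div, zero_smul]
  have hfe : f = fun _ => 0 :=
    Continuous.ext_on (dense_compl_singleton x₀) hf.continuous continuous_const (fun x hx => hoff x hx)
  intro x
  rw [hfe]

end Summit.NavierStokesRegularity.NavierStokesRegularity.Theorems.UnthreadedRigidity.Polyhedral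

end
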